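import Summits.AtomisticToContinuum.Crystallization.Theorems.PalmUnimodularRigidityMinimiserShellsResidual
import Summits.AtomisticToContinuum.Crystallization.Theorems.PalmUnimodularRigidityMinimiserShellsLooseGoodShellMeasurable
import Summits.AtomisticToContinuum.Crystallization.Theorems.PalmUnimodularRigidityMinimiserShellsSepQualLooseGap
import Summits.AtomisticToContinuum.Crystallization.Theorems.PalmUnimodularRigidityMinimiserShellsAeLooseGoodShell
import Summits.AtomisticToContinuum.Crystallization.Theorems.PalmUnimodularRigidityMinimiserShellsPatternCovering
import Summits.AtomisticToContinuum.Crystallization.Theorems.PalmUnimodularRigidityMinimiserShellsBoundaryShell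
import Summits.AtomisticToContinuum.Crystallization.Theorems.PalmUnimodularRigidityCruxesToPalmRigidity

/-!
# Crux `MinimiserShells` (stmt-AtomisticToContinuum-9225) IS its residual: `MinimiserShells ↔ ∀ θ ∈ (0, 1/10], ShellGap θ`

Route `PalmUnimodularRigidity`, line `elastic-coarse-to-fine`, skeleton r5 (lead `…-c15`, 2026-08-17).

The landed sandwich (`Residual.minimiserShells_sandwich`, p121752 / p123347) pinned the crux between `ShellGap 0` and
every `ShellGap θ`, `θ ∈ (0, 1/10]`, "up to the closed-tolerance boundary of the shell predicate".  This file removes the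
caveat: the loosened gaps ALONE imply the crux (`minimiserShells_of_shellGapAll`), so

  `MinimiserShells ↔ ∀ θ ∈ (0, 1/10], ShellGap θ`   (`minimiserShells_iff_shellGapAll`).

The crux is therefore EXACTLY the (arbitrarily finely) loosened `1/3`-hard-core periodic first-shell gap for
three-dimensional Lennard-Jones — bulk 3-D LJ crystallization in first-shell form (Blanc–Lewin 2015 §2.3: open) — and
nothing else: every proof of the crux proves all loosened gaps (necessity, landed) and every proof of all loosened gaps
proves the crux (this file).

Proof of sufficiency (composition of five landed stubs of skeleton r5; no energy estimate beyond the landed transfer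
machinery).  Fix a minimising point-stationary `δ`-hard-core law `P`.  For every level `θₙ = 1/(n+10)`:
`ShellGap θₙ` ⟹ the finite no-boundary loose gap on `1/3`-separated configurations
(`SepQualLooseGap.stub_sepQualLooseGap`) ⟹ `P`-a.s. the root shell is `θₙ`-loosely good
(`AeLooseGoodShell.stub_aeLooseGoodShell`, with the measurability `LooseGoodShellMeasurable.stub_looseGoodShellMeasurable`);
hence a.s. ALL loosened tests pass at the root, and — by the landed root-to-every-atom transport
`PalmUnimodularRigidity.ae_forall_map_sub_of_ae` — the `1/100`-loosened test passes at every atom.  The boundary lemma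
`BoundaryShell.stub_boundaryShell` (compactness of `[9/10,1] × Iso(ℝ³)` + the `45°` covering radius of the kissing
patterns, `PatternCovering.stub_patternCovering`, excluding a 13th atom at exactly `‖k‖ = 5a/4`) then gives the EXACT
good shell a.s.
-/

noncomputable section

open MeasureTheory
open scoped ENNReal BigOperators Classical

namespace Summit.AtomisticToContinuum.Crystallization.Theorems.PalmUnimodularRigidityMinimiserShells.ExactResidual

open Literature.Probability.Process (IsPointStationaryLaw IsRootedHardCore count_restrict_singleton_ne_zero_iff
  map_sub_count_restrict)
open Summit.AtomisticToContinuum.Crystallization.Theses.PalmUnimodularRigidity (MinimiserShells)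
open Summit.AtomisticToContinuum.Crystallization.Theorems.MinimiserShells.Negative.LoadBearing
  (eStar GoodShell meanRootEnergy minimiserShells_iff)
open Summit.AtomisticToContinuum.Crystallization.Theorems.PalmUnimodularRigidityMinimiserShells.Residual
  (ShellGap LooseGoodShell shellGap_of_minimiserShells shellGap_zero_iff_forall)
open Summit.AtomisticToContinuum.Crystallization.Theorems.PalmUnimodularRigidity
  (ae_forall_map_sub_of_ae count_restrict_floorNorm_preimage_lt_top)

/-- **All loosened test levels pass a.s. at the root.**  Under `∀ θ ∈ (0, 1/10], ShellGap θ`, every minimising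
point-stationary `δ`-hard-core law has, almost surely, a root shell passing the `1/(n+10)`-loosened test for every `n`. -/
theorem ae_forall_looseGoodShell (h : ∀ θ : ℝ, 0 < θ → θ ≤ 1 / 10 → ShellGap θ)
    {δ : ℝ} (hδ : 0 < δ) {P : Measure (Measure (EuclideanSpace ℝ (Fin 3)))} [IsProbabilityMeasure P]
    (hcore : ∀ᵐ μ ∂P, IsRootedHardCore δ μ) (hstat : IsPointStationaryLaw P) (hE : meanRootEnergy P ≤ eStar) :
    ∀ᵐ μ ∂P, ∀ n : ℕ, LooseGoodShell (1 / ((n : ℝ) + 10)) μ := by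
  refine ae_all_iff.2 fun n => ?_
  have hθ0 : (0 : ℝ) < 1 / ((n : ℝ) + 10) := by positivity
  have hθ1 : 1 / ((n : ℝ) + 10) ≤ 1 / 10 :=
    one_div_le_one_div_of_le (by norm_num) (by linarith [(Nat.cast_nonneg n : (0 : ℝ) ≤ n)])
  exact AeLooseGoodShell.stub_aeLooseGoodShell _ hθ0.le
    (LooseGoodShellMeasurable.stub_looseGoodShellMeasurable _ hθ0.le)
    (SepQualLooseGap.stub_sepQualLooseGap _ hθ0.le (h _ hθ0 hθ1)) δ hδ P inferInstance hcore hstat hE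

/-- **Sufficiency of the loosened gaps**: `(∀ θ ∈ (0, 1/10], ShellGap θ) → MinimiserShells`. -/
theorem minimiserShells_of_shellGapAll : (∀ θ : ℝ, 0 < θ → θ ≤ 1 / 10 → ShellGap θ) → MinimiserShells := by
  intro h
  rw [minimiserShells_iff]
  intro δ hδ P hP hcore hstat hE
  have hall := ae_forall_looseGoodShell h hδ hcore hstat hE
  -- level `1/100 = θ_90`, transported to every atom
  have h100 : ∀ᵐ μ ∂P, LooseGoodShell (1 / 100) μ := by
    filter_upwards [hall] with μ hμ
    have h := hμ 90
    have he : (1 : ℝ) / ((90 : ℕ) + 10 : ℝ) = 1 / 100 := by norm_num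
    simpa only [he] using h
  have hlf : ∀ᵐ μ ∂P, ∀ n : ℕ, μ ((fun z : EuclideanSpace ℝ (Fin 3) => ⌊‖z‖⌋₊) ⁻¹' {n}) < ⊤ := by
    filter_upwards [hcore] with μ hμ n
    obtain ⟨S, -, hsep, rfl⟩ := hμ
    exact count_restrict_floorNorm_preimage_lt_top hδ hsep n
  have hatoms : ∀ᵐ μ ∂P, ∀ y : EuclideanSpace ℝ (Fin 3), μ {y} ≠ 0 →
      LooseGoodShell (1 / 100) (Measure.map (fun z => z - y) μ) :=
    ae_forall_map_sub_of_ae hstat hlf h100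
  -- the boundary lemma, pointwise
  filter_upwards [hcore, hall, hatoms] with μ hμ hallμ hatμ
  obtain ⟨S, h0, hsep, rfl⟩ := hμ
  refine BoundaryShell.stub_boundaryShell PatternCovering.stub_patternCovering δ hδ S h0 hsep hallμ fun y hy => ?_
  have h := hatμ y ((count_restrict_singleton_ne_zero_iff S y).2 hy)
  rwa [map_sub_count_restrict] at h

/-- **The crux IS its residual.**  `MinimiserShells` (stmt-AtomisticToContinuum-9225) holds if and only if every
loosened `1/3`-hard-core periodic first-shell gap `ShellGap θ`, `θ ∈ (0, 1/10]`, holds (necessity: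
`Residual.shellGap_of_minimiserShells`, p123347; sufficiency: `minimiserShells_of_shellGapAll`). -/
theorem minimiserShells_iff_shellGapAll : MinimiserShells ↔ ∀ θ : ℝ, 0 < θ → θ ≤ 1 / 10 → ShellGap θ :=
  ⟨fun h _ hθ hθ' => shellGap_of_minimiserShells h hθ hθ', minimiserShells_of_shellGapAll⟩

/-- **Corollary: the fine gap `ShellGap 0` implies all its loosenings and hence the crux** — a second proof of
`Residual.minimiserShells_of_shellGap_zero` through the loosened side (`Residual.shellGap_zero_iff_forall`). -/
theorem minimiserShells_of_shellGap_zero' (h : ShellGap 0) : MinimiserShells :=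
  minimiserShells_of_shellGapAll fun θ hθ hθ' => (shellGap_zero_iff_forall.1 h) θ hθ.le hθ'

end Summit.AtomisticToContinuum.Crystallization.Theorems.PalmUnimodularRigidityMinimiserShells.ExactResidual

end
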